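import Summits.ValiantsHypothesis.ValiantsHypothesis.Theorems.LacunarySymmetroidMatrixDescartesCensusReflectGauss
import Summits.ValiantsHypothesis.ValiantsHypothesis.Theorems.LacunarySymmetroidMatrixDescartesCensusKit
import Summits.ValiantsHypothesis.ValiantsHypothesis.Theorems.KPlusLogSqLawLiftingGeneralExcessNoGo

/-!
# `MatrixDescartes` census — reflective certificates for the GENERAL (non-symmetric) control column

HONEST FRAMING.  Bookkeeping for the experiment cell `val-V1-extremal` (engine seat val-v1x-eng-4 g2, the «general-class
control column» of the extremal grid) beside the open crux `Theses.LacunarySymmetroid.MatrixDescartes`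
(stmt-ValiantsHypothesis-18050, asymptotic, SYMMETRIC pencils).  The control column records, per format `(m, K)`, lower bounds
for `ζ_gen(m,K)` = the largest number of distinct positive determinant roots of a `K`-letter pencil of ARBITRARY real `m × m`
matrices — the tree's `Prop` `GenPosRootLawAt m K B` of `…KPlusLogSqLawLiftingGeneralExcessNoGo` (val-idea-1), which so far has
kernel rows only at `(2,6)` and `(3,4)`.  This file is the general-class twin of val-v1x-eng-10's reflective kit
`…CensusReflect` / val-v1x-eng-8's `…CensusReflectGauss`: the Boolean check `certCheckN` is `certCheckG` WITHOUT the symmetry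
conjunct (positivity and strict increase of the `N + 1` rational test points `a j / b j`, exact integer determinant signs by
fraction-free Gaussian elimination strictly alternating), and the soundness theorem `not_genPosRootLawAt_of_certCheckN` turns
one kernel evaluation `certCheckN … = true` (by `decide +kernel`) into `¬ GenPosRootLawAt m K B` for every `B < N`
(intermediate value theorem, tree lemma `le_card_posRoots_of_certificate`).  Nothing here bears on `MatrixDescartes`, on the
doors `DoorA34` / `DoorA26`, or on `VP ≠ VNP`: finite control data only.

[folklore] Descartes / intermediate value theorem; kernel reflection.
-/

-- `Summit.ValiantsHypothesis.ValiantsHypothesis.…` repeats a component by the D-0017 layout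
-- (single-conjunct summit), which the `dupNamespace` linter flags; the name is mandated.
set_option linter.dupNamespace false

namespace Summit.ValiantsHypothesis.ValiantsHypothesis.Theorems.LacunarySymmetroidMatrixDescartes.Census.Reflect

open Summit.ValiantsHypothesis.ValiantsHypothesis.Theorems.KPlusLogSqLaw.GeneralExcess (GenPosRootLawAt)
open Summit.ValiantsHypothesis.ValiantsHypothesis.Theorems.LacunarySymmetroidMatrixDescartes.Census
  (le_card_posRoots_of_certificate)
open scoped BigOperators Matrix
open Polynomial

/-- **The certificate check for GENERAL integer pencils** `F = ∑ l, X^{d l} • S l` (`S l` arbitrary integer `m × m`,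
`K` letters) and `N + 1` rational test points `a j / b j`: `0 < a j`, `0 < b j`; points strictly increasing; consecutive exact
determinant signs (fraction-free Gauss, `signAtG`) multiply to `−1`.  (= `certCheckG` without the symmetry conjunct.) [folklore] -/
def certCheckN (m K N : ℕ) (d : Fin K → ℕ) (S : Fin K → Fin m → Fin m → ℤ) (a b : Fin (N + 1) → ℕ) : Bool :=
  (finAll (N + 1) (fun j => decide (0 < a j) && decide (0 < b j))
  && (finAll N (fun i => decide (a i.castSucc * b i.succ < a i.succ * b i.castSucc))
  && finAll N (fun i => signAtG m K (finMax K d) d S (a i.castSucc) (b i.castSucc)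
        * signAtG m K (finMax K d) d S (a i.succ) (b i.succ) == -1)))

/-- **Reflective certificate ⇒ at least `N` positive roots (no symmetry asked).**  If `certCheckN m K N d S a b = true` then the
real pencil with letters `(S l i j : ℝ)` has `N + 1` positive points with strictly alternating determinant signs, hence at least
`N` distinct positive determinant roots. [folklore] -/
theorem le_card_posRoots_of_certCheckN {m K N : ℕ} {d : Fin K → ℕ} {S : Fin K → Fin m → Fin m → ℤ}
    {a b : Fin (N + 1) → ℕ} (h : certCheckN m K N d S a b = true) :
    N ≤ (((∑ l, (X : ℝ[X]) ^ d l • (Matrix.of fun i j => (S l i j : ℝ)).map Polynomial.C).det).roots.toFinset.filter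
      (fun t => 0 < t)).card := by
  simp only [certCheckN, Bool.and_eq_true, signAtG_eq] at h
  obtain ⟨hpos, hmono, hsign⟩ := h
  have ha : ∀ j, 0 < a j := fun j => by
    have := of_finAll hpos j; simp only [Bool.and_eq_true, decide_eq_true_eq] at this; exact this.1
  have hb : ∀ j, 0 < b j := fun j => by
    have := of_finAll hpos j; simp only [Bool.and_eq_true, decide_eq_true_eq] at this; exact this.2
  have hlt : ∀ i : Fin N, a i.castSucc * b i.succ < a i.succ * b i.castSucc := fun i => by
    simpa using of_finAll hmono i
  have hsg : ∀ i : Fin N, signAt m K (finMax K d) d S (a i.castSucc) (b i.castSucc)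
      * signAt m K (finMax K d) d S (a i.succ) (b i.succ) = -1 := fun i => by
    simpa using of_finAll hsign i
  set SR : Fin K → Matrix (Fin m) (Fin m) ℝ := fun l => Matrix.of fun i j => (S l i j : ℝ) with hSR
  let τ : Fin (N + 1) → ℝ := fun j => (a j : ℝ) / (b j : ℝ)
  have hbR : ∀ j, (0 : ℝ) < b j := fun j => by exact_mod_cast hb j
  have hτpos : ∀ j, 0 < τ j := fun j => div_pos (by exact_mod_cast ha j) (hbR j)
  have hτ : StrictMono τ := by
    refine Fin.strictMono_iff_lt_succ.mpr (fun i => ?_)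
    show (a i.castSucc : ℝ) / b i.castSucc < (a i.succ : ℝ) / b i.succ
    rw [div_lt_div_iff₀ (hbR _) (hbR _)]
    exact_mod_cast hlt i
  refine le_card_posRoots_of_certificate (d := d) (S := SR)
    (q := fun t => (∑ l, t ^ d l • SR l).det) (fun t => rfl) τ hτ hτpos (fun i => ?_)
  have hD : ∀ l, d l ≤ finMax K d := le_finMax d
  have key : ∀ j : Fin (N + 1),
      ((b j : ℝ) ^ finMax K d) ^ m * (∑ l, τ j ^ d l • SR l).det
        = (idet m (evalAt m K (finMax K d) d S (a j) (b j)) : ℝ) := fun j =>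
    det_evalAt d hD S (a j) (b j) (ne_of_gt (hbR j))
  have hc : ∀ j : Fin (N + 1), (0 : ℝ) < ((b j : ℝ) ^ finMax K d) ^ m := fun j =>
    pow_pos (pow_pos (hbR j) _) _
  have hneg := mul_neg_of_sign (hsg i)
  rw [← key, ← key] at hneg
  have hcc : (0 : ℝ) < ((b i.castSucc : ℝ) ^ finMax K d) ^ m * ((b i.succ : ℝ) ^ finMax K d) ^ m :=
    mul_pos (hc _) (hc _)
  have hprod : ((b i.castSucc : ℝ) ^ finMax K d) ^ m * ((b i.succ : ℝ) ^ finMax K d) ^ m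
      * ((∑ l, τ i.castSucc ^ d l • SR l).det * (∑ l, τ i.succ ^ d l • SR l).det) < 0 := by
    calc ((b i.castSucc : ℝ) ^ finMax K d) ^ m * ((b i.succ : ℝ) ^ finMax K d) ^ m
          * ((∑ l, τ i.castSucc ^ d l • SR l).det * (∑ l, τ i.succ ^ d l • SR l).det)
        = (((b i.castSucc : ℝ) ^ finMax K d) ^ m * (∑ l, τ i.castSucc ^ d l • SR l).det)
          * ((((b i.succ : ℝ) ^ finMax K d) ^ m) * (∑ l, τ i.succ ^ d l • SR l).det) := by ring
      _ < 0 := hneg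
  exact lt_of_not_ge (fun hge => absurd hprod (not_lt.mpr (mul_nonneg hcc.le hge)))

/-- **Reflective certificate ⇒ control row**: `certCheckN m K N d S a b = true` gives `¬ GenPosRootLawAt m K B` for every
`B < N` (the general, non-symmetric positive-root law of the census control column fails below `N`). [folklore] -/
theorem not_genPosRootLawAt_of_certCheckN {m K N B : ℕ} {d : Fin K → ℕ} {S : Fin K → Fin m → Fin m → ℤ}
    {a b : Fin (N + 1) → ℕ} (h : certCheckN m K N d S a b = true) (hB : B < N) :
    ¬ GenPosRootLawAt m K B := by
  intro hlaw
  have hle := hlaw d (fun l => Matrix.of fun i j => (S l i j : ℝ))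
  have hN := le_card_posRoots_of_certCheckN h
  omega

/-! ### Smoke test (tiny, non-symmetric): `det [[t − 1, 1], [0, t − 2]] = (t−1)(t−2)` alternates `+,−,+` at `1/2, 3/2, 4`. -/

/-- a 2×2 two-letter upper-triangular (non-symmetric) toy row: `ζ_gen(2,2) ≥ 2`, by reflection. [folklore] -/
theorem toy_not_genPosRootLawAt_2_2_1 : ¬ GenPosRootLawAt 2 2 1 :=
  not_genPosRootLawAt_of_certCheckN (m := 2) (K := 2) (N := 2) (d := ![0, 1])
    (S := ![![![-1, 1], ![0, -2]], ![![1, 0], ![0, 1]]]) (a := ![1, 3, 4]) (b := ![2, 2, 1])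
    (by decide +kernel) (by norm_num)

end Summit.ValiantsHypothesis.ValiantsHypothesis.Theorems.LacunarySymmetroidMatrixDescartes.Census.Reflect
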